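import Mathlib
import Literature.NumberTheory.DiophantineGeometry.PartitionTableauxProofs
import Literature.NumberTheory.DiophantineGeometry.SchurWeylPlethysmHwMultiplicityProofs
import Literature.Probability.LatticeModels.UniformStepWalk

/-!
# `GradedDesignFamily` (stmt-MatrixMultiplication-7610), line `schur-weyl-colour-cells`:
# STUB B `stub_twoRowBudgetRate` — the two-row budget rate

Crux `…Theses.LevelGradedCohnUmans.GradedDesignFamily` (summit `MatrixMultiplication`); skeleton
`Cruxes/GradedDesignFamily/Lines/schur_weyl_colour_cells.lean` (lead reshape: stubs A, B, C);
this file proves the registered stub `stub_twoRowBudgetRate` verbatim (name + signature,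
tree-only vocabulary) and lands `--supports stmt-MatrixMultiplication-7610`.

**Statement.** For every `s > 2` there are `K`, `θ > 0` with
`Σ_{μ ⊢ n, ℓ(μ) ≤ 2} (f^μ)^s ≤ K · (4^n / n^{3/2})^{s/2} · n^{-θ}` for all `n ≥ 1`
(`f^μ = numStandardTableaux μ`; the two-row degree power sums lose a power of `n` against the
proxy wall `P(n) = 4^n/n^{3/2}`).  We get `θ = (s-2)/4` (the truth) and `K = 32 · 32^{(s-1)/2}`.

**Proof** (elementary, no Stirling; `m = ⌊n/2⌋`, `M = m + 1`, `C = C(n, m)`).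
1. A shape with `≤ 2` rows is `(n)` or `(n-b, b)`, `1 ≤ b ≤ m`, determined by `b = λ₂`
   (`twoRowBudget_sortedParts_of_card_le_two`, `twoRowBudget_eq_of_getD_eq`); ballot numbers
   `f^{(n-b,b)} (n-b+1) = C(n,b) (n-2b+1)` by the tree's Frobenius–Young formula
   `card_stdFilling_mul_prod_factorial` with `N = 2` rows (`twoRowBudget_degree_mul_eq`).
2. `b = m - t`: `f ≤ 4 C (t+1)/((t+1)² + M)` (`twoRowBudget_degree_le`) by the binomial tail
   `C(n, m-t)((t+1)² + M) ≤ 2M C` (`twoRowBudget_choose_tail`, induction on `t`).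
3. AM–GM `φ_t = (t+1)/((t+1)²+M) ≤ 1/(2√M)` gives `f^s ≤ (2C/√M)^{s-2} (4Cφ_t)²`; the
   shapes inject into `t ∈ [0, m]`, and `Σ_t φ_t² ≤ 2/√M` by telescoping
   (`twoRowBudget_profile_sq_sum_le`); so `Σ (f^μ)^s ≤ 32 (2C/√M)^{s-2} C²/√M`
   (`twoRowBudget_sum_le`).
4. `C² (n+1) ≤ 4^n` (tree: `choose_half_sq_mul_succ_le`) and `n ≤ 2M` give
   `K 2^{ns} n^{1/2-s} = K (4^n/n^{3/2})^{s/2} n^{-(s-2)/4}` (`twoRowBudget_assemble`, in logs).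

Tree inputs: `numStandardTableaux_eq_card_stdFilling`, `card_stdFilling_mul_prod_factorial`,
`rowLen_youngDiagram`, `fst_lt_of_mem_youngDiagram`, the `Nat.Partition.sortedParts` API,
`Literature.Probability.LatticeModels.UniformStep.choose_half_sq_mul_succ_le`.
Supports item `stmt-MatrixMultiplication-7610`; theorems only, no definitions.
-/

-- `Summit.<Summit>.<Problem>` is the tree's mandated summit-side namespace; for this
-- single-conjunct summit the two coincide, so the file silences `dupNamespace`.
set_option linter.dupNamespace false

noncomputable section

open scoped BigOperators
open Literature.NumberTheory.DiophantineGeometry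
open Literature.Probability.LatticeModels.UniformStep (choose_half_sq_mul_succ_le)

namespace Summit.MatrixMultiplication.MatrixMultiplication.Theorems.GradedDesignFamily

/-- A partition of `n ≥ 1` with at most two parts is `(n)` or `(n - b, b)` with `1 ≤ b ≤ n/2`
(as sorted parts). -/
theorem twoRowBudget_sortedParts_of_card_le_two {n : ℕ} (hn : 1 ≤ n) (μ : Nat.Partition n)
    (h : Multiset.card μ.parts ≤ 2) :
    μ.sortedParts = [n] ∨
      ∃ b : ℕ, 1 ≤ b ∧ 2 * b ≤ n ∧ μ.sortedParts = [n - b, b] := by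
  have hlen : μ.sortedParts.length ≤ 2 := by rw [Nat.Partition.length_sortedParts]; exact h
  have hsum := μ.sum_sortedParts
  have hsort := μ.sortedGE_sortedParts
  have hpos : ∀ a ∈ μ.sortedParts, 0 < a := fun a ha => μ.pos_of_mem_sortedParts ha
  rcases hl : μ.sortedParts with _ | ⟨x, _ | ⟨y, _ | ⟨z, l⟩⟩⟩
  · rw [hl] at hsum; simp at hsum; omega
  · left; rw [hl] at hsum; simp at hsum; rw [hsum]
  · right
    rw [hl] at hsum hsort hpos
    simp only [List.sum_cons, List.sum_nil, add_zero] at hsum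
    rw [List.sortedGE_iff_pairwise] at hsort
    have hyx : y ≤ x := by simp at hsort; exact hsort
    have hy : 0 < y := hpos y (by simp)
    exact ⟨y, hy, by omega, by rw [show x = n - y by omega]⟩
  · rw [hl] at hlen; simp at hlen

/-- Partitions with at most two parts are determined by their second sorted part. -/
theorem twoRowBudget_eq_of_getD_eq {n : ℕ} (hn : 1 ≤ n) {μ₁ μ₂ : Nat.Partition n}
    (h₁ : Multiset.card μ₁.parts ≤ 2) (h₂ : Multiset.card μ₂.parts ≤ 2)
    (he : μ₁.sortedParts.getD 1 0 = μ₂.sortedParts.getD 1 0) : μ₁ = μ₂ := by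
  have key : μ₁.sortedParts = μ₂.sortedParts := by
    rcases twoRowBudget_sortedParts_of_card_le_two hn μ₁ h₁ with e₁ | ⟨b₁, hb₁, -, e₁⟩ <;>
      rcases twoRowBudget_sortedParts_of_card_le_two hn μ₂ h₂ with e₂ | ⟨b₂, hb₂, -, e₂⟩ <;>
        rw [e₁, e₂] at he ⊢ <;> simp at he <;> first | rfl | omega | (subst he; rfl)
  have hp : ∀ μ : Nat.Partition n, μ.parts = (μ.sortedParts : Multiset ℕ) := fun μ =>
    (Multiset.sort_eq _ _).symm
  exact Nat.Partition.ext (by rw [hp μ₁, hp μ₂, key])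

/-- **Ballot-number form of the two-row degrees**: for `μ ⊢ n`, `n ≥ 1`, with at most two
parts and second part `b = λ₂` (`0` for the one-row shape), `2b ≤ n` and
`f^μ · (n - b + 1) = C(n, b) · (n - 2b + 1)` (i.e. `f^{(n-b,b)} = C(n,b) - C(n,b-1)`), from the
tree's Frobenius–Young determinantal formula `card_stdFilling_mul_prod_factorial` with `N = 2`
rows, `β = (λ₁ + 1, λ₂)`: `f^μ · (λ₁ + 1)! · λ₂! = n! · (λ₁ + 1 - λ₂)`. -/
theorem twoRowBudget_degree_mul_eq {n : ℕ} (hn : 1 ≤ n) (μ : Nat.Partition n)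
    (h : Multiset.card μ.parts ≤ 2) :
    2 * μ.sortedParts.getD 1 0 ≤ n ∧
      numStandardTableaux μ * (n - μ.sortedParts.getD 1 0 + 1) =
        n.choose (μ.sortedParts.getD 1 0) * (n - 2 * μ.sortedParts.getD 1 0 + 1) := by
  -- the two rows `λ₁ = n - b`, `λ₂ = b`
  obtain ⟨b, hb2, hr0, hr1, hgetD⟩ : ∃ b : ℕ, 2 * b ≤ n ∧ μ.youngDiagram.rowLen 0 = n - b ∧
      μ.youngDiagram.rowLen 1 = b ∧ μ.sortedParts.getD 1 0 = b := by
    rcases twoRowBudget_sortedParts_of_card_le_two hn μ h with e | ⟨b, -, hb, e⟩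
    · exact ⟨0, by omega, by rw [rowLen_youngDiagram, e]; rfl,
        by rw [rowLen_youngDiagram, e]; rfl, by rw [e]; rfl⟩
    · exact ⟨b, hb, by rw [rowLen_youngDiagram, e]; rfl, by rw [rowLen_youngDiagram, e]; rfl,
        by rw [e]; rfl⟩
  rw [hgetD]
  refine ⟨hb2, ?_⟩
  -- Frobenius–Young with two rows: `f · (λ₁ + 1)! · λ₂! = n! · (λ₁ + 1 - λ₂)` (in `ℚ`)
  classical
  have hN : ∀ c ∈ μ.youngDiagram.cells, c.1 < 2 := fun c hc =>
    fst_lt_of_mem_youngDiagram μ h hc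
  have key := card_stdFilling_mul_prod_factorial 2 n μ.youngDiagram μ.card_cells_youngDiagram hN
  have hI0 : Finset.Ioo 0 2 = {1} := by decide
  have hI1 : Finset.Ioo 1 2 = ∅ := by decide
  simp only [Finset.prod_range_succ, Finset.range_one, Finset.prod_singleton, hI0, hI1,
    Finset.prod_empty, mul_one, Nat.sub_self, add_zero, hr0, hr1,
    ← numStandardTableaux_eq_card_stdFilling] at key
  -- `n! = C(n,b) · b! · (n-b)!` and `(n-b+1)! = (n-b+1) · (n-b)!`
  have hchoose : (n.factorial : ℚ) = n.choose b * b.factorial * (n - b).factorial := by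
    exact_mod_cast (Nat.choose_mul_factorial_mul_factorial (show b ≤ n by omega)).symm
  rw [show n - b + (2 - 1 - 0) = n - b + 1 by rfl, Nat.factorial_succ, hchoose] at key
  push_cast at key
  have hfac : ((b.factorial : ℚ) * ((n - b).factorial : ℚ)) ≠ 0 := by positivity
  have key' : ((numStandardTableaux μ * (n - b + 1) : ℕ) : ℚ) =
      ((n.choose b * (n - 2 * b + 1) : ℕ) : ℚ) := by
    apply mul_right_cancel₀ hfac
    push_cast [Nat.cast_sub (show b ≤ n by omega), Nat.cast_sub hb2]
    rw [Nat.cast_sub (show b ≤ n by omega)] at key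
    linear_combination key
  exact_mod_cast key'

/-- **Polynomial tail of the binomial profile**: for `2m ≤ n` and `j + t = m`,
`C(n, j) · (2m + 2 + t(t+1)) ≤ (2m + 2) · C(n, m)` (induction on `t` with the ratio
`C(n, j) (n - j) = C(n, j+1) (j+1)`). -/
theorem twoRowBudget_choose_tail {n m : ℕ} (hm : 2 * m ≤ n) :
    ∀ t j : ℕ, j + t = m →
      n.choose j * (2 * m + 2 + t * (t + 1)) ≤ (2 * m + 2) * n.choose m := by
  intro t
  induction t with
  | zero => intro j hj; rw [add_zero] at hj; subst hj; simp [mul_comm]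
  | succ t ih =>
    intro j hj
    have ih' := ih (j + 1) (by omega)
    have hrat := Nat.choose_succ_right_eq n j
    have hnj : 0 < n - j := by omega
    refine Nat.le_of_mul_le_mul_right ?_ hnj
    have hpoly : (j + 1) * (2 * m + 2 + (t + 1) * (t + 1 + 1)) ≤
        (j + 2 * t + 2) * (2 * m + 2 + t * (t + 1)) := by
      have : (j + 2 * t + 2) * (2 * m + 2 + t * (t + 1)) =
          (j + 1) * (2 * m + 2 + (t + 1) * (t + 1 + 1)) +
            (2 * t ^ 3 + 7 * t ^ 2 + 2 * j * t + 9 * t + 2) := by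
        subst hj; ring
      rw [this]
      exact Nat.le_add_right _ _
    calc n.choose j * (2 * m + 2 + (t + 1) * (t + 1 + 1)) * (n - j)
        = n.choose (j + 1) * ((j + 1) * (2 * m + 2 + (t + 1) * (t + 1 + 1))) := by
          rw [mul_right_comm, ← hrat]; ring
      _ ≤ n.choose (j + 1) * ((j + 2 * t + 2) * (2 * m + 2 + t * (t + 1))) :=
          Nat.mul_le_mul_left _ hpoly
      _ ≤ n.choose (j + 1) * ((n - j) * (2 * m + 2 + t * (t + 1))) :=
          Nat.mul_le_mul_left _ (Nat.mul_le_mul_right _ (by omega))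
      _ = n.choose (j + 1) * (2 * m + 2 + t * (t + 1)) * (n - j) := by ring
      _ ≤ (2 * m + 2) * n.choose m * (n - j) := Nat.mul_le_mul_right _ ih'

/-- **Per-shape bound**: for `μ ⊢ n` (`n ≥ 1`) with at most two parts and second part
`b = m - t`, `m = ⌊n/2⌋`, one has `f^μ ≤ 4 · C(n, m) · (t+1)/((t+1)² + m + 1)`
(ballot formula, `n - 2b + 1 ≤ 2t + 2`, `n - b + 1 ≥ m + 1`, and the binomial tail
`C(n, m-t)((t+1)² + m + 1) ≤ 2(m+1) C(n, m)`). -/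
theorem twoRowBudget_degree_le {n : ℕ} (hn : 1 ≤ n) (μ : Nat.Partition n)
    (h : Multiset.card μ.parts ≤ 2) :
    (numStandardTableaux μ : ℝ) ≤ 4 * (n.choose (n / 2) : ℝ) *
      ((((n / 2 - μ.sortedParts.getD 1 0 : ℕ) : ℝ) + 1) /
        ((((n / 2 - μ.sortedParts.getD 1 0 : ℕ) : ℝ) + 1) ^ 2 + ((n / 2 : ℕ) + 1))) := by
  obtain ⟨hb2, hdeg⟩ := twoRowBudget_degree_mul_eq hn μ h
  set b := μ.sortedParts.getD 1 0 with hb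
  set m := n / 2 with hm
  have h2m : 2 * m ≤ n := by omega
  have hbm : b ≤ m := by omega
  set t := m - b with ht
  set f := numStandardTableaux μ
  have htail := twoRowBudget_choose_tail h2m t b (by omega)
  have key : f * ((t + 1) ^ 2 + (m + 1)) ≤ 4 * n.choose m * (t + 1) := by
    refine Nat.le_of_mul_le_mul_right ?_ (Nat.succ_pos m)
    calc f * ((t + 1) ^ 2 + (m + 1)) * (m + 1)
        = f * (m + 1) * ((t + 1) ^ 2 + (m + 1)) := by ring
      _ ≤ f * (n - b + 1) * (2 * m + 2 + t * (t + 1)) :=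
          Nat.mul_le_mul (Nat.mul_le_mul_left _ (by omega)) (by nlinarith [Nat.sub_le m b])
      _ = n.choose b * (n - 2 * b + 1) * (2 * m + 2 + t * (t + 1)) := by rw [hdeg]
      _ ≤ n.choose b * (2 * t + 2) * (2 * m + 2 + t * (t + 1)) :=
          Nat.mul_le_mul_right _ (Nat.mul_le_mul_left _ (by omega))
      _ = (2 * t + 2) * (n.choose b * (2 * m + 2 + t * (t + 1))) := by ring
      _ ≤ (2 * t + 2) * ((2 * m + 2) * n.choose m) := Nat.mul_le_mul_left _ htail
      _ = 4 * n.choose m * (t + 1) * (m + 1) := by ring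
  have hden : (0 : ℝ) < ((t : ℝ) + 1) ^ 2 + ((m : ℝ) + 1) := by positivity
  rw [← mul_div_assoc, le_div_iff₀ hden]
  exact_mod_cast key

/-- **Profile sum**: for `M ≥ 1`, `Σ_{t<M} ((t+1)/((t+1)² + M))² ≤ 2/√M`: each term is at
most `1/((t+1)² + M) ≤ 2/((t + √M)(t + 1 + √M)) = 2/(t + √M) - 2/(t + 1 + √M)` (as
`(t + 1 + √M)² ≤ 2((t+1)² + M)`), and the bound telescopes. -/
theorem twoRowBudget_profile_sq_sum_le {M : ℕ} (hM : 1 ≤ M) :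
    ∑ t ∈ Finset.range M, (((t : ℝ) + 1) / (((t : ℝ) + 1) ^ 2 + M)) ^ 2 ≤
      2 / Real.sqrt M := by
  have hMpos : (0 : ℝ) < M := by exact_mod_cast hM
  set r : ℝ := Real.sqrt M with hr
  have hr0 : 0 < r := Real.sqrt_pos.2 hMpos
  have hsq : r ^ 2 = (M : ℝ) := Real.sq_sqrt hMpos.le
  have hterm : ∀ t ∈ Finset.range M, (((t : ℝ) + 1) / (((t : ℝ) + 1) ^ 2 + M)) ^ 2 ≤
      2 / ((t : ℝ) + r) - 2 / ((t : ℝ) + 1 + r) := by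
    intro t _
    have ht : (0 : ℝ) ≤ t := Nat.cast_nonneg t
    rw [div_pow, div_sub_div _ _ (by positivity) (by positivity),
      div_le_div_iff₀ (by positivity) (by positivity), ← hsq]
    have h1 : ((t : ℝ) + r) * ((t : ℝ) + 1 + r) ≤ 2 * (((t : ℝ) + 1) ^ 2 + r ^ 2) := by
      nlinarith [sq_nonneg ((t : ℝ) + 1 - r)]
    have h2 : ((t : ℝ) + 1) ^ 2 ≤ ((t : ℝ) + 1) ^ 2 + r ^ 2 := by nlinarith
    calc ((t : ℝ) + 1) ^ 2 * (((t : ℝ) + r) * ((t : ℝ) + 1 + r))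
        ≤ (((t : ℝ) + 1) ^ 2 + r ^ 2) * (2 * (((t : ℝ) + 1) ^ 2 + r ^ 2)) :=
          mul_le_mul h2 h1 (by positivity) (by positivity)
      _ = (2 * ((t : ℝ) + 1 + r) - ((t : ℝ) + r) * 2) * (((t : ℝ) + 1) ^ 2 + r ^ 2) ^ 2 := by
          ring
  calc ∑ t ∈ Finset.range M, (((t : ℝ) + 1) / (((t : ℝ) + 1) ^ 2 + M)) ^ 2
      ≤ ∑ t ∈ Finset.range M, (2 / ((t : ℝ) + r) - 2 / ((t : ℝ) + 1 + r)) :=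
        Finset.sum_le_sum hterm
    _ = 2 / r - 2 / ((M : ℝ) + r) := by
        have h := Finset.sum_range_sub' (fun t : ℕ => 2 / ((t : ℝ) + r)) M
        simp only [Nat.cast_zero, zero_add, Nat.cast_succ] at h
        rw [← h]
    _ ≤ 2 / r := by
        have : (0 : ℝ) ≤ 2 / ((M : ℝ) + r) := by positivity
        linarith

/-- **The two-row degree power sum against the central binomial coefficient**: for `n ≥ 1`,
`s ≥ 2`, `m = ⌊n/2⌋`, `C = C(n, m)`, `M = m + 1`,
`Σ_{μ ⊢ n, ℓ(μ) ≤ 2} (f^μ)^s ≤ 32 · (2C/√M)^{s-2} · C² / √M`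
(per shape `f ≤ x := 4Cφ(t) ≤ y := 2C/√M` by AM–GM, so `f^s ≤ y^{s-2} x²`; the shapes
inject into `t ∈ [0, m]`; then the profile sum `Σ φ² ≤ 2/√M`). -/
theorem twoRowBudget_sum_le {n : ℕ} (hn : 1 ≤ n) {s : ℝ} (hs : 2 ≤ s) :
    (∑ μ : Nat.Partition n, if Multiset.card μ.parts ≤ 2 then
        (numStandardTableaux μ : ℝ) ^ s else 0) ≤
      32 * (2 * (n.choose (n / 2) : ℝ) / Real.sqrt (((n / 2 : ℕ) : ℝ) + 1)) ^ (s - 2) *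
        (n.choose (n / 2) : ℝ) ^ 2 / Real.sqrt (((n / 2 : ℕ) : ℝ) + 1) := by
  classical
  set m := n / 2 with hm
  set C : ℝ := (n.choose m : ℝ) with hC
  set M : ℝ := ((m : ℕ) : ℝ) + 1 with hM
  have hM0 : 0 < M := by positivity
  have hsM : 0 < Real.sqrt M := Real.sqrt_pos.2 hM0
  set φ : ℕ → ℝ := fun t => ((t : ℝ) + 1) / (((t : ℝ) + 1) ^ 2 + M) with hφ
  have hφle : ∀ t, φ t ≤ 1 / (2 * Real.sqrt M) := by
    intro t
    rw [hφ, div_le_div_iff₀ (by positivity) (by positivity)]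
    nlinarith [sq_nonneg ((t : ℝ) + 1 - Real.sqrt M), Real.sq_sqrt hM0.le]
  set y : ℝ := 2 * C / Real.sqrt M with hy
  have hy' : 4 * C * (1 / (2 * Real.sqrt M)) = y := by rw [hy]; field_simp; ring
  -- per shape: `f^s ≤ y^(s-2) · (4 C φ t)²` by AM–GM
  have hterm : ∀ μ ∈ (Finset.univ : Finset (Nat.Partition n)).filter
      (fun μ => Multiset.card μ.parts ≤ 2),
      (numStandardTableaux μ : ℝ) ^ s ≤
        y ^ (s - 2) * (16 * C ^ 2 * φ (m - μ.sortedParts.getD 1 0) ^ 2) := by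
    intro μ hμ
    rw [Finset.mem_filter] at hμ
    set x : ℝ := 4 * C * φ (m - μ.sortedParts.getD 1 0) with hx
    have hfx : (numStandardTableaux μ : ℝ) ≤ x := twoRowBudget_degree_le hn μ hμ.2
    have hx0 : 0 ≤ x := by positivity
    have hxy : x ≤ y := by
      rw [← hy', hx]
      exact mul_le_mul_of_nonneg_left (hφle _) (by positivity)
    calc (numStandardTableaux μ : ℝ) ^ s ≤ x ^ s :=
          Real.rpow_le_rpow (by positivity) hfx (by linarith)
      _ = x ^ (s - 2) * x ^ 2 := by
          rw [← Real.rpow_two, ← Real.rpow_add_of_nonneg hx0 (by linarith) (by norm_num)]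
          ring_nf
      _ ≤ y ^ (s - 2) * x ^ 2 :=
          mul_le_mul_of_nonneg_right (Real.rpow_le_rpow hx0 hxy (by linarith)) (sq_nonneg x)
      _ = y ^ (s - 2) * (16 * C ^ 2 * φ (m - μ.sortedParts.getD 1 0) ^ 2) := by
          rw [hx]; ring
  -- the shapes inject into `t = m - λ₂ ∈ [0, m]`
  have hinj : Set.InjOn (fun μ : Nat.Partition n => m - μ.sortedParts.getD 1 0)
      ↑((Finset.univ : Finset (Nat.Partition n)).filter (fun μ => Multiset.card μ.parts ≤ 2)) := by
    intro μ₁ h₁ μ₂ h₂ he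
    simp only [Finset.coe_filter, Finset.mem_univ, true_and, Set.mem_setOf_eq] at h₁ h₂
    have hb₁ := (twoRowBudget_degree_mul_eq hn μ₁ h₁).1
    have hb₂ := (twoRowBudget_degree_mul_eq hn μ₂ h₂).1
    dsimp only at he
    exact twoRowBudget_eq_of_getD_eq hn h₁ h₂ (by omega)
  have hprof : ∑ t ∈ Finset.range (m + 1), φ t ^ 2 ≤ 2 / Real.sqrt M := by
    have h := twoRowBudget_profile_sq_sum_le (M := m + 1) (by omega)
    push_cast at h; exact h
  rw [← Finset.sum_filter]
  calc ∑ μ ∈ Finset.univ.filter (fun μ : Nat.Partition n => Multiset.card μ.parts ≤ 2),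
        (numStandardTableaux μ : ℝ) ^ s
      ≤ ∑ μ ∈ Finset.univ.filter (fun μ : Nat.Partition n => Multiset.card μ.parts ≤ 2),
          y ^ (s - 2) * (16 * C ^ 2 * φ (m - μ.sortedParts.getD 1 0) ^ 2) :=
        Finset.sum_le_sum hterm
    _ = ∑ t ∈ (Finset.univ.filter (fun μ : Nat.Partition n => Multiset.card μ.parts ≤ 2)).image
          (fun μ : Nat.Partition n => m - μ.sortedParts.getD 1 0),
            y ^ (s - 2) * (16 * C ^ 2 * φ t ^ 2) :=
        (Finset.sum_image (f := fun t => y ^ (s - 2) * (16 * C ^ 2 * φ t ^ 2)) hinj).symm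
    _ ≤ ∑ t ∈ Finset.range (m + 1), y ^ (s - 2) * (16 * C ^ 2 * φ t ^ 2) :=
        -- adapted from Literature/NumberTheory/Sieve/HeathBrownCubicNuSum.lean
        Finset.sum_le_sum_of_subset_of_nonneg
          (Finset.image_subset_iff.mpr fun μ _ => Finset.mem_range.2 (by omega))
          fun t _ _ => by positivity
    _ = y ^ (s - 2) * (16 * C ^ 2) * ∑ t ∈ Finset.range (m + 1), φ t ^ 2 := by
        rw [Finset.mul_sum]; exact Finset.sum_congr rfl fun t _ => by ring
    _ ≤ y ^ (s - 2) * (16 * C ^ 2) * (2 / Real.sqrt M) :=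
        mul_le_mul_of_nonneg_left hprof (by positivity)
    _ = 32 * y ^ (s - 2) * C ^ 2 / Real.sqrt M := by ring

/-- **Exponent bookkeeping** (logarithmic form): with `C² N ≤ P` (central binomial bound,
`P = 4^n`) and `N ≤ 2M` (`M = ⌊n/2⌋ + 1`),
`32 (2C/√M)^{s-2} C²/√M ≤ 32 · 32^{(s-1)/2} · (P/N^{3/2})^{s/2} · N^{-(s-2)/4}`
for `s > 2`. -/
theorem twoRowBudget_assemble {s N C M P : ℝ} (hs : 2 < s) (hN : 0 < N) (hC : 0 < C)
    (hM : 0 < M) (hP : 0 < P) (hCN : C ^ 2 * N ≤ P) (hNM : N ≤ 2 * M) :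
    32 * (2 * C / Real.sqrt M) ^ (s - 2) * C ^ 2 / Real.sqrt M ≤
      32 * 32 ^ ((s - 1) / 2) * (P / N ^ ((3 : ℝ) / 2)) ^ (s / 2) * N ^ (-((s - 2) / 4)) := by
  have hsM : 0 < Real.sqrt M := Real.sqrt_pos.2 hM
  have hX : 0 < 2 * C / Real.sqrt M := by positivity
  have hN32 : 0 < N ^ ((3 : ℝ) / 2) := Real.rpow_pos_of_pos hN _
  have hPN : 0 < P / N ^ ((3 : ℝ) / 2) := div_pos hP hN32
  rw [← Real.log_le_log_iff (by positivity) (by positivity)]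
  -- expand the logarithms
  have hL : Real.log (32 * (2 * C / Real.sqrt M) ^ (s - 2) * C ^ 2 / Real.sqrt M) =
      Real.log 32 + (s - 2) * (Real.log 2 + Real.log C - Real.log M / 2) + 2 * Real.log C -
        Real.log M / 2 := by
    rw [Real.log_div (by positivity) hsM.ne', Real.log_mul (by positivity) (by positivity),
      Real.log_mul (by positivity) (by positivity), Real.log_rpow hX, Real.log_div (by positivity)
      hsM.ne', Real.log_mul (by norm_num) hC.ne', Real.log_sqrt hM.le, Real.log_pow]
    push_cast
    ring
  have hR : Real.log (32 * 32 ^ ((s - 1) / 2) * (P / N ^ ((3 : ℝ) / 2)) ^ (s / 2) *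
      N ^ (-((s - 2) / 4))) =
      Real.log 32 + (s - 1) / 2 * Real.log 32 + s / 2 * (Real.log P - 3 / 2 * Real.log N) +
        -((s - 2) / 4) * Real.log N := by
    rw [Real.log_mul (by positivity) (by positivity), Real.log_mul (by positivity) (by positivity),
      Real.log_mul (by positivity) (by positivity), Real.log_rpow (by norm_num), Real.log_rpow hPN,
      Real.log_div hP.ne' hN32.ne', Real.log_rpow hN, Real.log_rpow hN]
  have h32 : Real.log 32 = 5 * Real.log 2 := by
    rw [show (32 : ℝ) = 2 ^ 5 by norm_num, Real.log_pow]; push_cast; ring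
  -- the two monotonicity inputs, in logarithmic form
  have g1 : 2 * Real.log C + Real.log N ≤ Real.log P := by
    have := Real.log_le_log (by positivity) hCN
    rwa [Real.log_mul (by positivity) hN.ne', Real.log_pow, Nat.cast_ofNat] at this
  have g2 : Real.log N ≤ Real.log 2 + Real.log M := by
    have := Real.log_le_log hN hNM
    rwa [Real.log_mul (by norm_num) hM.ne'] at this
  rw [hL, hR]
  have hs0 : 0 ≤ s / 2 := by linarith
  have hs1 : 0 ≤ (s - 1) / 2 := by linarith
  nlinarith [mul_nonneg hs0 (show 0 ≤ Real.log P - 2 * Real.log C - Real.log N by linarith),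
    mul_nonneg hs1 (show 0 ≤ Real.log 2 + Real.log M - Real.log N by linarith),
    mul_nonneg hs0 (Real.log_nonneg one_le_two)]

/-- **STUB B `stub_twoRowBudgetRate` (two-row budget rate).** For every `s > 2` there are `K`
and `θ > 0` (here `θ = (s-2)/4`, `K = 32 · 32^{(s-1)/2}`) with
`Σ_{μ ⊢ n, ℓ(μ) ≤ 2} (f^μ)^s ≤ K · (4^n / n^{3/2})^{s/2} · n^{-θ}` for all `n ≥ 1`
(`twoRowBudget_sum_le` + `C(n,⌊n/2⌋)²(n+1) ≤ 4^n` + `twoRowBudget_assemble`). -/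
theorem stub_twoRowBudgetRate (s : ℝ) (hs : 2 < s) :
    ∃ K θ : ℝ, 0 < θ ∧ ∀ n : ℕ, 1 ≤ n →
      (∑ μ : Nat.Partition n, if Multiset.card μ.parts ≤ 2 then
          (Literature.NumberTheory.DiophantineGeometry.numStandardTableaux μ : ℝ) ^ s else 0) ≤
        K * ((4 : ℝ) ^ n / (n : ℝ) ^ ((3 : ℝ) / 2)) ^ (s / 2) * (n : ℝ) ^ (-θ) := by
  refine ⟨32 * 32 ^ ((s - 1) / 2), (s - 2) / 4, by linarith, fun n hn => ?_⟩
  refine (twoRowBudget_sum_le hn hs.le).trans ?_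
  have hN : (0 : ℝ) < n := by exact_mod_cast hn
  have hC : (0 : ℝ) < (n.choose (n / 2) : ℝ) := by
    exact_mod_cast Nat.choose_pos (Nat.div_le_self n 2)
  have hCN : (n.choose (n / 2) : ℝ) ^ 2 * n ≤ (4 : ℝ) ^ n := by
    exact_mod_cast (Nat.mul_le_mul_left _ (Nat.le_succ n)).trans (choose_half_sq_mul_succ_le n)
  have hNM : (n : ℝ) ≤ 2 * (((n / 2 : ℕ) : ℝ) + 1) := by
    have : n ≤ 2 * (n / 2 + 1) := by omega
    exact_mod_cast this
  exact twoRowBudget_assemble hs hN hC (by positivity) (by positivity) hCN hNM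

end Summit.MatrixMultiplication.MatrixMultiplication.Theorems.GradedDesignFamily

end
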